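import Summits.QuantumFields.YangMills.Theorems.LangevinControlUVOSLegsAtWeakCouplingCSketchOutputs
import Summits.QuantumFields.YangMills.Theses.PencilRigidity
import Summits.QuantumFields.YangMills.Theorems.PencilRigidityKernelTransfer
import Summits.QuantumFields.YangMills.Theorems.PencilRigidityShellRigidity
import Summits.QuantumFields.YangMills.Theorems.PencilRigidityCurvatureChannel
import HarnessLib

/-!
# Crux `OSLegsAtWeakCouplingC` (stmt-QuantumFields-16207), line `Sketch`: the E1 import discharged by route `PencilRigidity`'s items

Support file (continuation lead c4).  Line `Sketch` is complete modulo three imports (skeleton v7, …SketchOutputs):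
E0′ (`MomentBounds6`), NT (`LowerBounds`) and E1 in germ form (`GermWard`).  This file shows that the E1 import need
not be promoted as a new item: it is implied, along every weak-coupling soft bundle, by THREE EXISTING ITEMS of route
`PencilRigidity` taken by name —

* `PencilRigidity.DiagonalMirrorRPR` (stmt-QuantumFields-10604, rated M): reflection positivity of the one-field
  curvature family in pull-back form for the four diagonal mirrors `x₀ = ±x₁`;
* `PencilRigidity.CurvatureKernelBound` (stmt-QuantumFields-11687): the two-point function of the family on `⁰𝒮` is
  integration against a real kernel `K(x₀ − x₁)` continuous off `0` with `|K(x)| ≤ C (1 + ‖x‖^(η−10))`;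
* `PencilRigidity.NPointIsotropy` (stmt-QuantumFields-11686, rated XL): for such a family with reflection positivity in
  the eight planar frames and a RADIAL two-point kernel, every `S₁ n` is invariant on `⁰𝒮` under the det-1 isometries
  of the `(x₀,x₁)`-plane —

together with the LANDED `KernelTransfer` (`kernelTransfer_proof`), `ShellRigidity` (`ShellRigidity_proof`: mass-shell
pencil rigidity, the kernel is O(4)-invariant off the origin) and the axis frames
(`CurvatureChannel.isReflectionPositive_comp_axisFrame`).  The point is that the soft-bundle limit `S₁` of the line
carries the whole one-species package `W₁` those items are stated over: lattice convergence of the renormalised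
curvature strings (bundle clause), E0 + hermiticity, E0′, E2 (`RPPos`, the rope), E3, E4 (`stub_cluster`), translations,
signed permutations (`stub_hypercubic`), the continuum gap (`stub_gap` + `Decay`) and the lattice gap (bundle clause) at
a common rate `min Δ Δ'` (`hasMassGap_anti`, `hasLatticeMassGap_anti`).  Hence

`osLegsAtWeakCouplingC_of_outputs_pencil :
   (E0′ import) → (NT import) → DiagonalMirrorRPR → CurvatureKernelBound → NPointIsotropy → OSLegsAtWeakCouplingC`,

a conditional theorem whose last three hypotheses are route decls of `PencilRigidity` verbatim (one proof of each serves
both routes); the germ machinery (`stub_locality`, `GermWard`) is not needed on this path, planar invariance being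
delivered globally on `⁰𝒮`.

Refs: OsterwalderSchrader1973 §4; FrohlichIsraelLiebSimon1978 (diagonal RP); GlimmJaffe1987 §6.1/§19; JaffeWitten2000 §4/§6.
-/

set_option autoImplicit false

noncomputable section

open scoped SchwartzMap ComplexConjugate BigOperators
open MeasureTheory Filter Topology
open Literature.MathematicalPhysics.QuantumFieldTheory Literature.MathematicalPhysics.QuantumLattice
open Literature.MathematicalPhysics.AQFT Literature.Probability.LatticeModels
open Summit.QuantumFields.YangMills.Theses.LangevinControlUV (OSLegsAtWeakCouplingC)
open Summit.QuantumFields.YangMills.Theses.PencilRigidity (DiagonalMirrorRPR CurvatureKernelBound NPointIsotropy)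
open Summit.QuantumFields.YangMills.Cruxes.OSLegsFromFemtoAndGap.DlrCollarTransfer
open Summit.QuantumFields.YangMills.Theorems.OSLegsFromFemtoAndGap (isHermitian_of_isReflectionPositive)
open Summit.QuantumFields.YangMills.Theorems.HypercubicLimit.Negative (onlySpecies extendByZero)
open Summit.QuantumFields.YangMills.Theorems.NPointIsotropy.Negative (E4)
open Summit.QuantumFields.YangMills.Theorems.KernelTransfer (kernelTransfer_proof)
open Summit.QuantumFields.YangMills.Cruxes.ShellRigidity.TransverseSmearingPlanarThreshold (ShellRigidity_proof)
open Summit.QuantumFields.YangMills.Theorems.CurvatureChannel (isReflectionPositive_comp_axisFrame)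

namespace Summit.QuantumFields.YangMills.Cruxes.OSLegsAtWeakCouplingC.Sketch

/-! ## §1 Gap clauses are monotone in the rate -/

section Gaps

/-- The continuum gap clause is monotone: a gap `Δ` is a gap `Δ' ≤ Δ`. -/
theorem hasMassGap_anti {ι : Type} {d : ℕ} [NeZero d] {S : LabelledSchwingerFamily ι (EuclideanSpace ℝ (Fin d))}
    {Δ Δ' : ℝ} (h : S.HasMassGap Δ) (hle : Δ' ≤ Δ) : S.HasMassGap Δ' := by
  intro n m k k' F G hF hG
  obtain ⟨C, hC⟩ := h n m k k' F G hF hG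
  refine ⟨max C 0, fun t ht H hH => (hC t ht H hH).trans ?_⟩
  calc C * Real.exp (-Δ * t) ≤ max C 0 * Real.exp (-Δ * t) :=
        mul_le_mul_of_nonneg_right (le_max_left _ _) (Real.exp_nonneg _)
    _ ≤ max C 0 * Real.exp (-Δ' * t) := by
        refine mul_le_mul_of_nonneg_left (Real.exp_le_exp.2 ?_) (le_max_right _ _)
        nlinarith

variable {G : Type} [Group G] [TopologicalSpace G] [IsTopologicalGroup G] [CompactSpace G]
  [MeasurableSpace G] [BorelSpace G]

/-- The lattice gap clause is monotone: a lattice gap `Δ` is a lattice gap `Δ' ≤ Δ` (spacings are positive). -/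
theorem hasLatticeMassGap_anti {ι : Type} (r : LatticeRep G) (sch : SpeciesScheme ι) {Δ Δ' : ℝ}
    (h : HasLatticeMassGap r sch Δ) (hle : Δ' ≤ Δ) : HasLatticeMassGap r sch Δ' := by
  intro A B
  obtain ⟨C, hC⟩ := h A B
  refine ⟨max C 0, hC.mono fun k hk S hS n hn => (hk S hS n hn).trans ?_⟩
  calc C * Real.exp (-(Δ * (sch.a k * n))) ≤ max C 0 * Real.exp (-(Δ * (sch.a k * n))) :=
        mul_le_mul_of_nonneg_right (le_max_left _ _) (Real.exp_nonneg _)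
    _ ≤ max C 0 * Real.exp (-(Δ' * (sch.a k * n))) := by
        refine mul_le_mul_of_nonneg_left (Real.exp_le_exp.2 ?_) (le_max_right _ _)
        have : 0 ≤ sch.a k * n := mul_nonneg (sch.a_pos k).le (Nat.cast_nonneg n)
        nlinarith

end Gaps

/-! ## §2 The crux from E0′, NT and the `PencilRigidity` items -/

/-- **The crux from E0′, NT and route `PencilRigidity`'s E1 engine** (conditional result): `OSLegsAtWeakCouplingC` BY
NAME from the two output-level hypothesis-side imports of line `Sketch` and the three `PencilRigidity` items
`DiagonalMirrorRPR` (stmt-10604), `CurvatureKernelBound` (stmt-11687), `NPointIsotropy` (stmt-11686), verbatim.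
Along the soft bundle chosen by `stub_growth`, the limit `S₁` carries the package `W₁` of those items (E2 by the rope,
E4 by `stub_cluster`, signed permutations by `stub_hypercubic`, both gaps at the rate `min Δ Δ'`); the axis frames are
reflection positive by `isReflectionPositive_comp_axisFrame`, the diagonal ones by `DiagonalMirrorRPR`; the two-point
kernel of `CurvatureKernelBound` is hypercubic and OS-positive across `x₀ = 0` and `x₀ = x₁` by the landed
`KernelTransfer`, hence radial by the landed `ShellRigidity`; `NPointIsotropy` then gives planar det-1 invariance on
`⁰𝒮`, Givens generation gives `SO(4)`, and the rest is the landed composition (OS axioms, extension by zero). -/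
theorem osLegsAtWeakCouplingC_of_outputs_pencil
    (hMB : ∀ (G : Type) [Group G] [TopologicalSpace G] [IsTopologicalGroup G] [CompactSpace G]
      [MeasurableSpace G] [BorelSpace G], IsCompactSimpleLieGroup G →
      ∀ (r : LatticeRep G) (a : ℝ → ℝ), Continuous a → TwoPoint G r a → Skewness G r a → GapInUnits G r a →
        MomentBounds6 G r a)
    (hLB : ∀ (G : Type) [Group G] [TopologicalSpace G] [IsTopologicalGroup G] [CompactSpace G]
      [MeasurableSpace G] [BorelSpace G], IsCompactSimpleLieGroup G →
      ∀ (r : LatticeRep G) (a : ℝ → ℝ), Continuous a → TwoPoint G r a → Skewness G r a → GapInUnits G r a →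
        LowerBounds G r a)
    (hDiag : DiagonalMirrorRPR) (hKB : CurvatureKernelBound) (hNP : NPointIsotropy) :
    OSLegsAtWeakCouplingC := by
  rw [cruxC_iff]
  intro G _ _ _ _ hG
  letI : MeasurableSpace G := borel G
  haveI : BorelSpace G := ⟨rfl⟩
  intro r a ha h1 h2 h3
  -- positivity and the limit of the unit map, from H1
  obtain ⟨-, -, -, -, -, -, -, hapos, ha0, -, -⟩ := id h1
  -- hypothesis side: the two output-level imports
  have hMB6 : MomentBounds6 G r a := hMB G hG r a ha h1 h2 h3
  have hLB' : LowerBounds G r a := hLB G hG r a ha h1 h2 h3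
  -- the rope's demands, then the soft bundle meeting them
  obtain ⟨b₀, g, Δ, hΔ, hRD⟩ := stub_rope G r a hapos ha0 h3
  obtain ⟨sch, S₁, Tq, K, hB⟩ := stub_growth G r a hapos ha0 hMB6 hLB' h3 b₀ g
  obtain ⟨hRP, hDec⟩ := hRD sch S₁ Tq K hB
  have hsigned : ∀ R : E4 ≃ₗᵢ[ℝ] E4, IsSignedPerm R → Invariant S₁ R :=
    fun R hR n F hF => stub_hypercubic G r a sch S₁ Tq K b₀ g hB n R hR F hF
  -- unpack the bundle
  obtain ⟨⟨hunits, -, -, hβ, hN, hLG, hE3, htrans, h0, h1', -, -, hYM, hnt, hng, ⟨Δ', hΔ', hlat⟩, -⟩, -⟩ := hB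
  -- continuum side, everything but rotations
  obtain ⟨hCS, hgapOf⟩ := stub_gap S₁ h0 htrans hRP
  have hE4 : S₁.toLabelled.HasClusterProperty :=
    stub_cluster S₁ Δ hΔ h0 h1' htrans (fun n R hR F hF => hsigned R hR n F hF) hCS hDec
  have hE2 : S₁.toLabelled.IsReflectionPositive := isReflectionPositive_of_rpPos hRP
  have hherm : S₁.toLabelled.IsHermitian := isHermitian_of_isReflectionPositive S₁ hN hE2
  have hgap : S₁.toLabelled.HasMassGap Δ := hgapOf Δ hΔ hDec
  have hhypDet : ∀ R : E4 ≃ₗᵢ[ℝ] E4, LinearMap.det (R.toLinearEquiv : E4 →ₗ[ℝ] E4) = 1 →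
      (∀ i : Fin 4, ∃ j : Fin 4, R (EuclideanSpace.single i 1) = EuclideanSpace.single j 1 ∨
        R (EuclideanSpace.single i 1) = -EuclideanSpace.single j 1) →
      ∀ (n : ℕ) (F : 𝓢((Fin n → E4), ℂ)), IsOffDiagonal F → S₁ n (linActMulti R F) = S₁ n F :=
    fun R _ hR n F hF => hsigned R hR n F hF
  -- the one-species package `W₁` of route `PencilRigidity`, at the common gap rate `min Δ Δ'`
  have hΔ₀ : 0 < min Δ Δ' := lt_min hΔ hΔ'
  have hgap₀ : S₁.toLabelled.HasMassGap (min Δ Δ') := hasMassGap_anti hgap (min_le_left _ _)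
  have hlat₀ : HasLatticeMassGap r sch (min Δ Δ') := hasLatticeMassGap_anti r sch hlat (min_le_right _ _)
  -- reflection positivity in the eight planar frames: axis frames by signed permutations, diagonal frames by the item
  have h8 : ∀ (R : E4 ≃ₗᵢ[ℝ] E4) (p q : ℝ), p ^ 2 + q ^ 2 = 1 → (p = 0 ∨ q = 0 ∨ p ^ 2 = q ^ 2) →
      R (EuclideanSpace.single 0 1) = p • EuclideanSpace.single 0 1 + q • EuclideanSpace.single 1 1 →
      (SchwingerFamily.toLabelled (fun n => (S₁ n).comp (linActMulti R))).IsReflectionPositive := by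
    intro R p q hpq hcase hR
    rcases hcase with hc | hc | hc
    · exact isReflectionPositive_comp_axisFrame S₁ hE2 hhypDet R p q hpq (Or.inl hc) hR
    · exact isReflectionPositive_comp_axisFrame S₁ hE2 hhypDet R p q hpq (Or.inr hc) hR
    · have hp : p ^ 2 = 1 / 2 := by linarith
      have hq : q ^ 2 = 1 / 2 := by linarith
      exact hDiag G hG r sch S₁ ⟨hYM, ⟨hN, hherm, hLG, hE2, hE3, hE4⟩, htrans, hhypDet, min Δ Δ', hΔ₀, hgap₀, hlat₀⟩
        R p q hp hq hR
  -- UV input: the real two-point kernel, continuous off 0, below |x|^(-10)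
  obtain ⟨Kk, C, η, hη, hcont, hbd, hrep⟩ :=
    hKB G hG r sch S₁ ⟨hYM, ⟨hN, hherm, hLG, hE2, hE3, hE4⟩, htrans, hhypDet, min Δ Δ', hΔ₀, hgap₀, hlat₀⟩
  -- distribution-level symmetries and the eight frames, moved to the kernel (landed `KernelTransfer`)
  obtain ⟨hB4, hpos0, hposD⟩ := kernelTransfer_proof S₁ Kk hcont hrep hE3 hhypDet h8
  -- mass-shell pencil rigidity (landed `ShellRigidity`): the kernel is O(4)-invariant off the origin
  have hiso := ShellRigidity_proof Kk hcont ⟨C, η, hη, hbd⟩ hB4 hpos0 hposD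
  -- n-point upgrade (the item): planar det-1 invariance on `⁰𝒮`
  have hplanarAll := hNP G hG r sch S₁
    ⟨hYM, ⟨hN, hherm, hLG, hE2, hE3, hE4⟩, htrans, hhypDet, min Δ Δ', hΔ₀, hgap₀, hlat₀⟩ h8 ⟨Kk, hcont, hiso, hrep⟩
  have hplanar : ∀ R : E4 ≃ₗᵢ[ℝ] E4, LinearMap.det (R.toLinearEquiv : E4 →ₗ[ℝ] E4) = 1 → IsPlanar01 R →
      Invariant S₁ R := fun R hdet hR n F hF => hplanarAll R hdet hR.1 hR.2 n F hF
  -- E1 by Givens generation, then the OS axioms of `S₁`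
  have hE1 : S₁.toLabelled.IsEuclideanInvariant := isEuclideanInvariant_of_planarRot S₁ htrans hsigned hplanar
  have hOS : OSAxiomsSchwinger S₁.toLabelled :=
    { normalized := hN, hermitian := hherm, invariant := hE1, reflectionPositive := hE2, symmetric := hE3,
      cluster := hE4, linearGrowth := hLG }
  -- one field extended by zero to all species
  have hnt' : ∃ (F₁ G₁ : 𝓢((Fin 1 → E4), ℂ)) (H₁ : 𝓢((Fin (1 + 1) → E4), ℂ)),
      IsTimeOrdered F₁ ∧ IsTimeOrdered G₁ ∧ IsAppendTensorOf H₁ (osAdjoint F₁) G₁ ∧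
        S₁ (1 + 1) H₁ ≠ S₁ 1 (osAdjoint F₁) * S₁ 1 G₁ := by
    simpa using hnt
  have hng' : ∃ (f g h : 𝓢(E4, ℂ)) (Ffgh : 𝓢((Fin 3 → E4), ℂ)) (Fgh Ffh Ffg : 𝓢((Fin 2 → E4), ℂ))
      (Ff Fg Fh : 𝓢((Fin 1 → E4), ℂ)),
      IsTensorOf Ffgh ![f, g, h] ∧ IsOffDiagonal Ffgh ∧ IsTensorOf Fgh ![g, h] ∧
      IsTensorOf Ffh ![f, h] ∧ IsTensorOf Ffg ![f, g] ∧ IsTensorOf Ff ![f] ∧ IsTensorOf Fg ![g] ∧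
      IsTensorOf Fh ![h] ∧
        S₁ 3 Ffgh - S₁ 1 Ff * S₁ 2 Fgh - S₁ 1 Fg * S₁ 2 Ffh - S₁ 1 Fh * S₁ 2 Ffg +
          2 * (S₁ 1 Ff * S₁ 1 Fg * S₁ 1 Fh) ≠ 0 := by
    simpa using hng
  obtain ⟨T, hYM', hntT, hngT⟩ := exists_osData_of_oneField r sch S₁ hOS hYM hnt' hng'
  exact ⟨onlySpecies sch r.curvature, T, hunits, hβ, hYM', hntT, hngT, Δ', hΔ', hlat⟩

end Summit.QuantumFields.YangMills.Cruxes.OSLegsAtWeakCouplingC.Sketch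

end
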